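import Mathlib
import Summits.CriticalPhenomena.SAWScalingLimit.Theses.SAWDefectDecoherence
import Summits.CriticalPhenomena.SAWScalingLimit.Theses.SAWPhaseRetrieval
import Summits.CriticalPhenomena.SAWScalingLimit.Theorems.SAWDefectDecoherenceConjugateClassNegligibleSums
import Literature.Barriers.CriticalPhenomena.ParafermionicHalfCauchyRiemann
import Literature.Probability.RandomPlanarGeometry.HexParafermionProofs
import Summits.CriticalPhenomena.SAWScalingLimit.Theorems.SAWDefectDecoherenceHexObservableLimitRReindex
import Summits.CriticalPhenomena.SAWScalingLimit.Theorems.SAWDefectDecoherenceHexObservableLimitRGreenLimit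
import Summits.CriticalPhenomena.SAWScalingLimit.Theorems.SAWDefectDecoherenceHexObservableLimitRDensityIntegrable
import HarnessLib

/-!
# Skeleton — crux `HexObservableLimitR` (stmt-CriticalPhenomena-14003), line `Ideator1Sketch`
(card antianalytic-collar-quadrature, merged with weak-curl-exact-interior; identification step
reshaped per TRIAGE r1-1 / r1-2: Green synthesis on `ℂ ∖ {a}` instead of Bergman uniqueness (U) +
near-root bound (NR); analysis layer reshaped (c7/c8) to the subsequence-free Cauchy-transform synthesis).

Composition (all finite sums are over the black→white ordered pairs `(v, t)`, `v, t ∈ Λ_δ`, `v` black,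
`v ∼ t` — one pair per INTERIOR mid-edge):

* `stub_massBound`      (SAW, open)  — b-normalised `L¹` mass bound on compacts of `ℂ ∖ {a}` (up to `∂Ω`).
* `stub_twistNull`      (SAW, open)  — the class-twisted pairing `δ² Σ u_e ∂χ(δe) F_δ(e)/F_δ(b_δ) → 0`
                                        for `χ ∈ C³_c(ℂ ∖ {a})` (boundary-inclusive alias death, Green form).
* `stub_boundaryFlux`   (SAW, open)  — the normalised boundary flux paired with `χ ∈ C³_c(ℂ ∖ {a})`
                                        converges to `c' ∫_Ω ∂̄χ · e^{(5/8)(L - L_b)}` with one universal `c' ≠ 0`.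
* `stub_densityIntegrable` (classical conformal maps) — `e^{(5/8)(L - L_b)} = (Φ'/Φ'(b))^{5/8}` is
                                        integrable on `Ω` away from the root.
* `stub_greenLimit`     (provable: DCS Lemma 1 summed against `χ(δ c_v)` — card 1's
                                        `WeightedGreenIdentity` — Taylor at mid-edges, limits).
* analysis layer      (pure analysis, provable): `stub_mollify`, `stub_invLocallyIntegrable`,
                                        `stub_cauchyPompeiu`, `stub_cauchyTransform`, `stub_holoOfDbar`,
                                        `stub_taylorUniform` + the glue `cauchySynthesis_of_stubs`
                                        (subsequence-free Cauchy-transform synthesis, c3/c5/c7 design; c9 runs it).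
* `stub_reindex`        (combinatorics, provable: the crux's `finsum` over mid-edges is the pair sum,
                                        boundary mid-edges carrying no `ψ`-mass eventually).

`HexObservableLimitR_of` assembles them into the crux BY NAME with `c = 6 c'`.

LANDED (imported): `stub_reindex` (Theorems/SAWDefectDecoherenceHexObservableLimitRReindex.lean, p87892),
`stub_greenLimit` (…GreenLimit.lean, p90531), `stub_densityIntegrable` (…DensityIntegrable.lean, p91481).
-/

noncomputable section

namespace Summit.CriticalPhenomena.SAWScalingLimit.Theorems.HexObservableLimitR

open Literature.Probability.RandomPlanarGeometry Literature.Probability.RandomPlanarGeometry.SAW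
open Literature.Probability.LatticeModels Literature.Barriers.CriticalPhenomena
open Literature.Barriers.CriticalPhenomena.HexGreen
open Summit.CriticalPhenomena.SAWScalingLimit.Theorems.ConjugateClassNegligibleSynthesis
open scoped BigOperators Topology ComplexConjugate
open Filter MeasureTheory Set Metric

/-! ### Stub 1 — the normalised mass bound (SAW input, open) -/

/-- **Mass bound (MB⁺).** In the setting of the crux, for every compact `K ⊆ ℂ` not containing the
root `a = D.pt 0` (it may meet `∂Ω` elsewhere), the `F_δ(b_δ)`-normalised `L¹`-mass of the critical
observable on the interior mid-edges with rescaled midpoint in `K` is eventually bounded: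
`δ² Σ_{e ⊂ Λ_δ, δe ∈ K} |F_δ(e)| / |F_δ(b_δ)| ≤ C_K`. -/
theorem stub_massBound (D : DobrushinDomain) (ρ : ℝ) (Λ : ℝ → Finset HexVertex)
    (m : Fin 2 → ℝ → ℤ) (a b : ℝ → Sym2 HexVertex)
    (Φ : ConformalEquiv D.carrier UpperHalfPlane.upperHalfPlaneSet) (L : ℂ → ℂ) (Lb : ℂ)
    (hρ : 0 < ρ)
    (hflat : ∀ i : Fin 2, D.carrier ∩ ball (D.pt i) ρ = {z : ℂ | (D.pt i).im < z.im} ∩ ball (D.pt i) ρ)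
    (hdisc : ∀ᶠ δ : ℝ in 𝓝[>] 0, hexDomainSimplyConnected (Λ δ) ∧ a δ ∈ hexDomainBoundary (Λ δ) ∧
      b δ ∈ hexDomainBoundary (Λ δ) ∧ Nonempty (HexMidEdgeSAW (Λ δ) (a δ) (b δ)) ∧
      (hexGraph.induce ((Λ δ : Finset HexVertex) : Set HexVertex)).Preconnected ∧
      (∀ v ∈ Λ δ, (δ : ℂ) * hexCenter v ∈ D.carrier) ∧
      (∀ i : Fin 2, ∀ v : HexVertex, (δ : ℂ) * hexCenter v ∈ ball (D.pt i) ρ → (v ∈ Λ δ ↔ m i δ ≤ v.1 1)))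
    (hexh : ∀ K : Set ℂ, IsCompact K → K ⊆ D.carrier → ∀ᶠ δ : ℝ in 𝓝[>] 0,
      ∀ v : HexVertex, (δ : ℂ) * hexCenter v ∈ K → v ∈ Λ δ)
    (ha : Tendsto (fun δ : ℝ => (δ : ℂ) * hexMidpoint (a δ)) (𝓝[>] 0) (𝓝 (D.pt 0)))
    (hb : Tendsto (fun δ : ℝ => (δ : ℂ) * hexMidpoint (b δ)) (𝓝[>] 0) (𝓝 (D.pt 1)))
    (hΦa : Tendsto (fun x => ‖Φ x‖) (𝓝[D.carrier] (D.pt 0)) atTop)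
    (hΦb : Φ.HasBoundaryValue (D.pt 1) 0)
    (hL : ContinuousOn L D.carrier) (hexpL : ∀ z ∈ D.carrier, Complex.exp (L z) = deriv Φ z)
    (hLb : Tendsto L (𝓝[D.carrier] (D.pt 1)) (𝓝 Lb)) :
    ∀ K : Set ℂ, IsCompact K → D.pt 0 ∉ K → ∃ C : ℝ, ∀ᶠ δ : ℝ in 𝓝[>] 0,
      ∑ v ∈ (Λ δ).filter (fun v => v.2 = 0), ∑ t ∈ (Λ δ).filter (fun t => hexGraph.Adj v t),
        K.indicator (fun _ =>
          ‖(δ : ℂ) ^ 2 * hexParafermionicObservable (Λ δ) (a δ) hexCriticalFugacity (5 / 8) s(v, t) /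
              hexParafermionicObservable (Λ δ) (a δ) hexCriticalFugacity (5 / 8) (b δ)‖)
          ((δ : ℂ) * hexMidpoint s(v, t)) ≤ C := by
  sorry

/-! ### Stub 2 — boundary-inclusive twist null in Green form (SAW input, open) -/

/-- **Twist null (Green form, boundary-inclusive).** In the setting of the crux, for every
`χ ∈ C³_c(ℂ ∖ {a})` the class-twisted pairing of `∂χ` with the normalised observable over the interior
mid-edges tends to `0`: `δ² Σ_{e={v,t} ⊂ Λ_δ} u_e ∂χ(δe) F_δ(e)/F_δ(b_δ) → 0`, `u_e = 12 (mid e - c_v)²`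
the unit squared edge direction. (Plain `ψ`-averages see only the class average; this is the weak
curl-freeness of card weak-curl-exact-interior, up to the boundary away from `a`.) -/
theorem stub_twistNull (D : DobrushinDomain) (ρ : ℝ) (Λ : ℝ → Finset HexVertex)
    (m : Fin 2 → ℝ → ℤ) (a b : ℝ → Sym2 HexVertex)
    (Φ : ConformalEquiv D.carrier UpperHalfPlane.upperHalfPlaneSet) (L : ℂ → ℂ) (Lb : ℂ)
    (hρ : 0 < ρ)
    (hflat : ∀ i : Fin 2, D.carrier ∩ ball (D.pt i) ρ = {z : ℂ | (D.pt i).im < z.im} ∩ ball (D.pt i) ρ)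
    (hdisc : ∀ᶠ δ : ℝ in 𝓝[>] 0, hexDomainSimplyConnected (Λ δ) ∧ a δ ∈ hexDomainBoundary (Λ δ) ∧
      b δ ∈ hexDomainBoundary (Λ δ) ∧ Nonempty (HexMidEdgeSAW (Λ δ) (a δ) (b δ)) ∧
      (hexGraph.induce ((Λ δ : Finset HexVertex) : Set HexVertex)).Preconnected ∧
      (∀ v ∈ Λ δ, (δ : ℂ) * hexCenter v ∈ D.carrier) ∧
      (∀ i : Fin 2, ∀ v : HexVertex, (δ : ℂ) * hexCenter v ∈ ball (D.pt i) ρ → (v ∈ Λ δ ↔ m i δ ≤ v.1 1)))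
    (hexh : ∀ K : Set ℂ, IsCompact K → K ⊆ D.carrier → ∀ᶠ δ : ℝ in 𝓝[>] 0,
      ∀ v : HexVertex, (δ : ℂ) * hexCenter v ∈ K → v ∈ Λ δ)
    (ha : Tendsto (fun δ : ℝ => (δ : ℂ) * hexMidpoint (a δ)) (𝓝[>] 0) (𝓝 (D.pt 0)))
    (hb : Tendsto (fun δ : ℝ => (δ : ℂ) * hexMidpoint (b δ)) (𝓝[>] 0) (𝓝 (D.pt 1)))
    (hΦa : Tendsto (fun x => ‖Φ x‖) (𝓝[D.carrier] (D.pt 0)) atTop)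
    (hΦb : Φ.HasBoundaryValue (D.pt 1) 0)
    (hL : ContinuousOn L D.carrier) (hexpL : ∀ z ∈ D.carrier, Complex.exp (L z) = deriv Φ z)
    (hLb : Tendsto L (𝓝[D.carrier] (D.pt 1)) (𝓝 Lb)) :
    ∀ χ : ℂ → ℂ, ContDiff ℝ 3 χ → HasCompactSupport χ → D.pt 0 ∉ tsupport χ →
      Tendsto (fun δ : ℝ =>
        ∑ v ∈ (Λ δ).filter (fun v => v.2 = 0), ∑ t ∈ (Λ δ).filter (fun t => hexGraph.Adj v t),
          (12 * (hexMidpoint s(v, t) - hexCenter v) ^ 2) *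
            ((fderiv ℝ χ ((δ : ℂ) * hexMidpoint s(v, t)) 1 -
                Complex.I * fderiv ℝ χ ((δ : ℂ) * hexMidpoint s(v, t)) Complex.I) / 2) *
            ((δ : ℂ) ^ 2 * hexParafermionicObservable (Λ δ) (a δ) hexCriticalFugacity (5 / 8) s(v, t) /
              hexParafermionicObservable (Λ δ) (a δ) hexCriticalFugacity (5 / 8) (b δ)))
        (𝓝[>] 0) (𝓝 0) := by
  sorry

/-! ### Stub 3 — the boundary flux limit in Green form (SAW input, open) -/

/-- **Boundary flux limit (Green form).** One universal `c' ≠ 0` such that, in the setting of the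
crux, for every `χ ∈ C³_c(ℂ ∖ {a})` the normalised boundary flux
`δ Σ_{v ∈ Λ_δ, u ∼ v, u ∉ Λ_δ} χ(δ c_v) (mid{v,u} - c_v) F_δ({v,u}) / F_δ(b_δ)` (boundary mid-edges only:
`|F_δ|` = arc partition function, `arg F_δ` = rigid boundary winding phase) converges to
`c' ∫_Ω ∂̄χ · e^{(5/8)(L - L_b)} dA`. -/
theorem stub_boundaryFlux : ∃ c' : ℂ, c' ≠ 0 ∧
    ∀ (D : DobrushinDomain) (ρ : ℝ) (Λ : ℝ → Finset HexVertex)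
    (m : Fin 2 → ℝ → ℤ) (a b : ℝ → Sym2 HexVertex)
    (Φ : ConformalEquiv D.carrier UpperHalfPlane.upperHalfPlaneSet) (L : ℂ → ℂ) (Lb : ℂ),
    0 < ρ →
    (∀ i : Fin 2, D.carrier ∩ ball (D.pt i) ρ = {z : ℂ | (D.pt i).im < z.im} ∩ ball (D.pt i) ρ) →
    (∀ᶠ δ : ℝ in 𝓝[>] 0, hexDomainSimplyConnected (Λ δ) ∧ a δ ∈ hexDomainBoundary (Λ δ) ∧
      b δ ∈ hexDomainBoundary (Λ δ) ∧ Nonempty (HexMidEdgeSAW (Λ δ) (a δ) (b δ)) ∧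
      (hexGraph.induce ((Λ δ : Finset HexVertex) : Set HexVertex)).Preconnected ∧
      (∀ v ∈ Λ δ, (δ : ℂ) * hexCenter v ∈ D.carrier) ∧
      (∀ i : Fin 2, ∀ v : HexVertex, (δ : ℂ) * hexCenter v ∈ ball (D.pt i) ρ →
        (v ∈ Λ δ ↔ m i δ ≤ v.1 1))) →
    (∀ K : Set ℂ, IsCompact K → K ⊆ D.carrier → ∀ᶠ δ : ℝ in 𝓝[>] 0,
      ∀ v : HexVertex, (δ : ℂ) * hexCenter v ∈ K → v ∈ Λ δ) →
    Tendsto (fun δ : ℝ => (δ : ℂ) * hexMidpoint (a δ)) (𝓝[>] 0) (𝓝 (D.pt 0)) →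
    Tendsto (fun δ : ℝ => (δ : ℂ) * hexMidpoint (b δ)) (𝓝[>] 0) (𝓝 (D.pt 1)) →
    Tendsto (fun x => ‖Φ x‖) (𝓝[D.carrier] (D.pt 0)) atTop →
    Φ.HasBoundaryValue (D.pt 1) 0 →
    ContinuousOn L D.carrier → (∀ z ∈ D.carrier, Complex.exp (L z) = deriv Φ z) →
    Tendsto L (𝓝[D.carrier] (D.pt 1)) (𝓝 Lb) →
    ∀ χ : ℂ → ℂ, ContDiff ℝ 3 χ → HasCompactSupport χ → D.pt 0 ∉ tsupport χ →
      Tendsto (fun δ : ℝ => (δ : ℂ) *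
        ∑ v ∈ Λ δ, ∑ u ∈ (nbrs v).filter (· ∉ Λ δ),
          χ ((δ : ℂ) * hexCenter v) * ((hexMidpoint s(v, u) - hexCenter v) *
            hexParafermionicObservable (Λ δ) (a δ) hexCriticalFugacity (5 / 8) s(v, u)) /
            hexParafermionicObservable (Λ δ) (a δ) hexCriticalFugacity (5 / 8) (b δ))
        (𝓝[>] 0)
        (𝓝 (c' * ∫ z in D.carrier,
          (fderiv ℝ χ z 1 + Complex.I * fderiv ℝ χ z Complex.I) / 2 *
            Complex.exp ((5 / 8 : ℂ) * (L z - Lb)))) := by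
  sorry



/-! ### Analysis layer (pure analysis, Mathlib vocabulary): six registered stubs + the Cauchy synthesis glue

The identification step is SUBSEQUENCE-FREE: for smooth `φ` the Cauchy transform
`θ = -(1/π) (φ ∗ (1/z))` solves `∂̄θ = φ`, is holomorphic off `supp φ` (so near the root `a`), and testing
the `∂̄`-moment hypothesis with `χ = θ · (1 - η_a) · η_R` (smooth cut-offs at the root and at infinity)
reduces the defect on `φ` to the defect on `θ ∂̄η_a`, which lives on a root-free compact annulus where
`θ` is a uniform limit of Taylor polynomials `q`; each `q ∂̄η_a = -∂̄(q (1 - η_a) η_R) +` (far term) is again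
an admissible `∂̄`-moment. Continuous `ψ` by mollification inside one compact of `Ω` plus the mass bound. -/

/-- **Mollification (stub A1).** A continuous compactly supported `ψ` with `tsupport ψ ⊆ U`, `U` open,
is a uniform limit of `C³` functions compactly supported inside `U` (convolution with a smooth bump
of small radius). [folklore] -/
theorem stub_mollify (U : Set ℂ) (hU : IsOpen U) (ψ : ℂ → ℂ) (hψ : Continuous ψ)
    (hψs : HasCompactSupport ψ) (hψU : tsupport ψ ⊆ U) (ε : ℝ) (hε : 0 < ε) :
    ∃ φ : ℂ → ℂ, ContDiff ℝ 3 φ ∧ HasCompactSupport φ ∧ tsupport φ ⊆ U ∧ ∀ z, ‖φ z - ψ z‖ ≤ ε := by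
  sorry

/-- **Local integrability of the Cauchy kernel (stub A2).** `t ↦ 1/t` is locally integrable on `ℂ`
for Lebesgue measure (polar coordinates: `∫_{|t|<R} |t|⁻¹ dA = 2πR`). [folklore] -/
theorem stub_invLocallyIntegrable : LocallyIntegrable (fun t : ℂ => t⁻¹) volume := by
  sorry

/-- **Cauchy–Pompeiu at the origin (stub A3).** For `φ ∈ C¹_c(ℂ)`,
`∫ ∂̄φ(w) / w dA(w) = -π φ(0)`, `∂̄ = (∂_x + i ∂_y)/2` (polar coordinates: the angular derivative
integrates to zero, the radial one to `-φ(0)` on every ray). [folklore] -/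
theorem stub_cauchyPompeiu (φ : ℂ → ℂ) (hφ : ContDiff ℝ 1 φ) (hφs : HasCompactSupport φ) :
    ∫ w : ℂ, w⁻¹ * ((fderiv ℝ φ w 1 + Complex.I * fderiv ℝ φ w Complex.I) / 2) =
      -(Real.pi : ℂ) * φ 0 := by
  sorry

/-- **Regularity of the Cauchy transform (stub A4).** For `φ ∈ C³_c(ℂ)` the convolution
`z ↦ ∫ t⁻¹ φ(z - t) dA(t)` is `C³` and its derivative is the convolution of `t⁻¹` with the derivative
of `φ` (differentiation under the integral sign; Mathlib's `HasCompactSupport.hasFDerivAt_convolution_right`).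
[folklore] -/
theorem stub_cauchyTransform (hk : LocallyIntegrable (fun t : ℂ => t⁻¹) volume) (φ : ℂ → ℂ)
    (hφ : ContDiff ℝ 3 φ) (hφs : HasCompactSupport φ) :
    ContDiff ℝ 3 (fun z : ℂ => ∫ t : ℂ, t⁻¹ * φ (z - t)) ∧
      ∀ z v : ℂ, fderiv ℝ (fun z : ℂ => ∫ t : ℂ, t⁻¹ * φ (z - t)) z v =
        ∫ t : ℂ, t⁻¹ * fderiv ℝ φ (z - t) v := by
  sorry

/-- **Pointwise Cauchy–Riemann (stub A5).** A real-differentiable `f` with `∂̄f(z) = 0` is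
complex-differentiable at `z` (its real derivative is complex-linear). [folklore] -/
theorem stub_holoOfDbar (f : ℂ → ℂ) (z : ℂ) (hf : DifferentiableAt ℝ f z)
    (h : fderiv ℝ f z 1 + Complex.I * fderiv ℝ f z Complex.I = 0) : DifferentiableAt ℂ f z := by
  sorry

/-- **Uniform Taylor approximation (stub A6).** A function holomorphic on `B(a, r)` is, on every
smaller closed disc `closedBall a r'` (`0 < r' < r`), a uniform limit of entire functions (partial sums
of its power series at `a`). [folklore] -/
theorem stub_taylorUniform (θ : ℂ → ℂ) (a : ℂ) (r r' : ℝ) (hr' : 0 < r') (hrr' : r' < r)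
    (hθ : DifferentiableOn ℂ θ (ball a r)) (ε : ℝ) (hε : 0 < ε) :
    ∃ q : ℂ → ℂ, Differentiable ℂ q ∧ ContDiff ℝ 3 q ∧ ∀ z ∈ closedBall a r', ‖q z - θ z‖ ≤ ε := by
  sorry

/-- **Cauchy synthesis (glue over stubs A1–A6, lead-held).** Let `Ω ⊆ ℂ` be open and bounded, `a ∉ Ω`,
`g` continuous on `Ω` and integrable on `Ω ∖ B(a, r)` for every `r > 0`. Let
`μ_δ = Σ_{p ∈ E_δ} w_δ(p) δ_{pt_δ(p)}` be finitely supported complex measures carried within distance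
`δ` of `Ω`, with total variation eventually bounded on every compact `K ∌ a`, whose `∂̄`-moments
converge: `∫ ∂̄χ dμ_δ → c ∫_Ω ∂̄χ g` for every `χ ∈ C³_c(ℂ ∖ {a})`. Then `∫ ψ dμ_δ → c ∫ ψ g` for
every `ψ ∈ C_c(Ω)`. (Cauchy transform + root/infinity cut-offs + Taylor approximation on the root
annulus + mollification; no subsequences, no Riesz functional.) -/
theorem cauchySynthesis_of_stubs {α : Type*} (Ω : Set ℂ) (hΩ : IsOpen Ω)
    (hΩb : Bornology.IsBounded Ω) (a : ℂ) (ha : a ∉ Ω) (g : ℂ → ℂ) (hg : ContinuousOn g Ω)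
    (hgi : ∀ r : ℝ, 0 < r → IntegrableOn g (Ω \ ball a r)) (c : ℂ)
    (E : ℝ → Finset α) (pt : ℝ → α → ℂ) (w : ℝ → α → ℂ)
    (hnear : ∀ᶠ δ : ℝ in 𝓝[>] 0, ∀ p ∈ E δ, infDist (pt δ p) Ω ≤ δ)
    (hmass : ∀ K : Set ℂ, IsCompact K → a ∉ K → ∃ C : ℝ, ∀ᶠ δ : ℝ in 𝓝[>] 0,
      ∑ p ∈ E δ, K.indicator (fun _ => ‖w δ p‖) (pt δ p) ≤ C)
    (hdbar : ∀ χ : ℂ → ℂ, ContDiff ℝ 3 χ → HasCompactSupport χ → a ∉ tsupport χ →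
      Tendsto (fun δ : ℝ => ∑ p ∈ E δ,
        (fderiv ℝ χ (pt δ p) 1 + Complex.I * fderiv ℝ χ (pt δ p) Complex.I) / 2 * w δ p)
        (𝓝[>] 0)
        (𝓝 (c * ∫ z in Ω, (fderiv ℝ χ z 1 + Complex.I * fderiv ℝ χ z Complex.I) / 2 * g z)))
    (ψ : ℂ → ℂ) (hψ : Continuous ψ) (hψs : HasCompactSupport ψ) (hψΩ : tsupport ψ ⊆ Ω) :
    Tendsto (fun δ : ℝ => ∑ p ∈ E δ, ψ (pt δ p) * w δ p) (𝓝[>] 0) (𝓝 (c * ∫ z, ψ z * g z)) := by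
  sorry

/-! ### Composition -/

/-- The root `D.pt 0` is a frontier point, hence not in the (open) carrier. [folklore] -/
theorem pt_not_mem_carrier (D : DobrushinDomain) (i : Fin 2) : D.pt i ∉ D.carrier := by
  intro h
  have hf : D.pt i ∈ frontier D.carrier := D.boundary_mem_frontier _
  rw [D.isOpen.frontier_eq] at hf
  exact hf.2 h

/-- **The line closes the crux.** `HexObservableLimitR` from the ten stubs, with `c = 6 c'`. -/
theorem HexObservableLimitR_of :
    Summit.CriticalPhenomena.SAWScalingLimit.Theses.SAWDefectDecoherence.HexObservableLimitR := by
  obtain ⟨c', hc', hBF⟩ := stub_boundaryFlux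
  refine ⟨6 * c', mul_ne_zero (by norm_num) hc', ?_⟩
  intro D ρ Λ m a b Φ L Lb ψ F hρ hflat hdisc hexh ha hb hΦa hΦb hL hexpL hLb hψc hψs hψΩ
  -- the inputs of the line, instantiated on this admissible family
  have hMB := stub_massBound D ρ Λ m a b Φ L Lb hρ hflat hdisc hexh ha hb hΦa hΦb hL hexpL hLb
  have hTN := stub_twistNull D ρ Λ m a b Φ L Lb hρ hflat hdisc hexh ha hb hΦa hΦb hL hexpL hLb
  have hBF' := hBF D ρ Λ m a b Φ L Lb hρ hflat hdisc hexh ha hb hΦa hΦb hL hexpL hLb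
  have hGL := stub_greenLimit D Λ a b L Lb (hdisc.mono fun δ h => ⟨h.1, h.2.1⟩) hMB hTN c' hBF'
  have hgi := stub_densityIntegrable D ρ Φ L Lb hρ hflat hΦa hΦb hL hexpL hLb
  have hpt : D.pt 0 ∉ D.carrier := pt_not_mem_carrier D 0
  have hg : ContinuousOn (fun z => Complex.exp ((5 / 8 : ℂ) * (L z - Lb))) D.carrier :=
    Complex.continuous_exp.comp_continuousOn (continuousOn_const.mul (hL.sub continuousOn_const))
  -- the finitely supported normalised measures on black→white interior pairs
  set E : ℝ → Finset (HexVertex × HexVertex) := fun δ =>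
    (((Λ δ).filter fun v => v.2 = 0) ×ˢ Λ δ).filter (fun p => hexGraph.Adj p.1 p.2) with hE
  set pt : ℝ → HexVertex × HexVertex → ℂ := fun δ p => (δ : ℂ) * hexMidpoint s(p.1, p.2) with hpt'
  set w : ℝ → HexVertex × HexVertex → ℂ := fun δ p =>
    (δ : ℂ) ^ 2 * F δ s(p.1, p.2) / F δ (b δ) with hw
  have hδpos : ∀ᶠ δ : ℝ in 𝓝[>] 0, 0 < δ := eventually_mem_nhdsWithin
  -- support within `δ` of `Ω`
  have hnear : ∀ᶠ δ : ℝ in 𝓝[>] 0, ∀ p ∈ E δ, infDist (pt δ p) D.carrier ≤ δ := by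
    filter_upwards [hdisc, hδpos] with δ hd hδ
    intro p hp
    rw [hE, mem_pairFinset] at hp
    obtain ⟨h1, -, -, hadj⟩ := hp
    have hin : (δ : ℂ) * hexCenter p.1 ∈ D.carrier := hd.2.2.2.2.2.1 p.1 h1
    calc infDist (pt δ p) D.carrier ≤ dist (pt δ p) ((δ : ℂ) * hexCenter p.1) :=
          infDist_le_dist_of_mem hin
      _ ≤ δ / 2 := dist_mid_center_le hδ.le hadj
      _ ≤ δ := by linarith
  -- the mass bound in the synthesis' format
  have hmass : ∀ K : Set ℂ, IsCompact K → D.pt 0 ∉ K → ∃ C : ℝ, ∀ᶠ δ : ℝ in 𝓝[>] 0,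
      ∑ p ∈ E δ, K.indicator (fun _ => ‖w δ p‖) (pt δ p) ≤ C := by
    intro K hK hKa
    obtain ⟨C, hC⟩ := hMB K hK hKa
    refine ⟨C, hC.mono fun δ hδ => ?_⟩
    rw [hE, sum_pairFinset_eq]
    convert hδ using 1
  -- the `∂̄`-moments
  have hdbar : ∀ χ : ℂ → ℂ, ContDiff ℝ 3 χ → HasCompactSupport χ → D.pt 0 ∉ tsupport χ →
      Tendsto (fun δ : ℝ => ∑ p ∈ E δ,
        (fderiv ℝ χ (pt δ p) 1 + Complex.I * fderiv ℝ χ (pt δ p) Complex.I) / 2 * w δ p)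
        (𝓝[>] 0)
        (𝓝 ((6 * c') * ∫ z in D.carrier,
          (fderiv ℝ χ z 1 + Complex.I * fderiv ℝ χ z Complex.I) / 2 *
            Complex.exp ((5 / 8 : ℂ) * (L z - Lb)))) := by
    intro χ hχ hχs hχa
    exact hGL χ hχ hχs hχa
  have key := cauchySynthesis_of_stubs D.carrier D.isOpen D.isBounded (D.pt 0) hpt
    (fun z => Complex.exp ((5 / 8 : ℂ) * (L z - Lb))) hg hgi (6 * c') E pt w hnear hmass hdbar
    ψ hψc hψs hψΩ
  have hre := stub_reindex D Λ a b ψ hexh hψc hψs hψΩ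
  refine key.congr' ?_
  filter_upwards [hre] with δ hδ
  exact hδ.symm

/-- **The line closes the crux for route SAWPhaseRetrieval too.** The SAWPhaseRetrieval copy of the
crux is the byte-identical proposition (one shared item stmt-CriticalPhenomena-14003). -/
theorem HexObservableLimitR_of_phaseRetrieval :
    Summit.CriticalPhenomena.SAWScalingLimit.Theses.SAWPhaseRetrieval.HexObservableLimitR :=
  HexObservableLimitR_of

end Summit.CriticalPhenomena.SAWScalingLimit.Theorems.HexObservableLimitR

end
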